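import Summits.BirchSwinnertonDyer.BirchSwinnertonDyer.Theorems.ClassRecordThreeCornerAtThreeKolyImageMachineShift
import Summits.BirchSwinnertonDyer.BirchSwinnertonDyer.Theorems.ErratumRoadFiveShimuraKolyvaginOrderBoundInertShiftEnd
import HarnessLib

/-!
# The IMAGE-KEYED Kolyvagin ORDER machine, I4e: the unit-index END on the inert locus — `Ш(E/K)[p^∞] = 0` and
# `#Ш(E/K)[p^∞] ≤ p^(2·ord_p[E(K):ℤP])` (`ord_p = 0`) from the depth-`k` ring-class-rational carrier and Poitou–Tate,
# for ANY odd `p`, from the four image inputs instead of `5 ≤ p` ∧ `ρ̄_{E,p}` onto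
# (crux `CornerAtThree`, item stmt-BirchSwinnertonDyer-19111, conjunct 3 along the CARRIER-INERT Shimura road;
# cell `bsd-stepL`, seat `bsd-stepL-corner3-p2` g5 = WIDTH-LEVER lane B; `--supports … --as helper`)

HONEST FRAMING: THEOREMS ONLY (no definition, no named fact, no `sorry`); nothing here is a BSD class theorem;
no census label moves (T7); item 19111 is NOT closed; every statement is CONDITIONAL on its displayed binders
exactly as its `hρ`-keyed original. BSD is not proved by any of this.

## The series (why this file exists)

Lane B's typed object `Theorems.CornerAtThreeShimuraInertDisplay` (conjunct 1 of the registered stub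
`stub_upper3_inertDisplay` of `Cruxes/CornerAtThree/Lines/inert.lean`, planner RULING 35) is Kolyvagin's UNSHARP
order bound `#Ш(E/K)[3^∞] ≤ 3^(2·ord₃[E(K):ℤP])` for the CM point of `X_{N⁺,N⁻}` with `3 ∣ N⁻` on the (T4″)₃
corner (`E[3]` irreducible, `ρ̄_{E,3}` NOT onto). The tree's Shimura–Kolyvagin ORDER chain
(`ErratumRoadFiveShimuraKolyvaginOrderBoundInert*`, `ClassRecordThreeShimuraKolyvaginOrderBoundAtThreeSurjOrderShift*`;
seats shim-p1 ∕ shim3a) is keyed on `hρ : ρ̄_{E,p}` ONTO, read ONLY through four consequences (seat shim3b g4 ∕ g5,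
memo `shim/SHIM3B-G5-NOTE-19616.md` §2 «execute only if a consumer appears» — the consumer is lane B's inert line):
(hIz) some `z ∈ Γ_K` acts as `−1` on `E(K̄)[p]`, (hIs) `E(K̄)[p]` is a simple `Γ_K`-module, (hIc) its
`Γ_K`-commutant is scalar, (hIt) `E(K)[p] = 0`. The series `ClassRecordThreeCornerAtThreeKolyImage*.lean`
(namespace `…Theorems.ShimuraKolyvaginOfImage`; theorem names = originals + `_ofImage`) re-keys the chain on these
four binders: statements and proofs are the originals VERBATIM with `hρ` replaced by `(hIz) (hIs) (hIc) (hIt)` and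
the image-reading leaves replaced by shim3b's landed twins (`ShimuraKolyvaginCebotarevOfImage.McCallum1991_cor_3_2_pow_of_image`,
`ShimuraKolyvaginCebotarevKernelOfImage.exists_kolyvaginPrime_gt_pow_kernel_of_image`,
`ShimuraKolyvaginFixedOfTorsion.{geomTorsion_pow_eq_zero_of_fixed, torsionH1OfDvd_pow_injective}_of_torsionBy_eq_bot`,
`KolyvaginDescent.*_of_torsionBy_eq_bot`). At `p = 3` the four inputs hold for EVERY irreducible `E[3]`
(`ShimuraKolyvaginOfImage.kolyvaginImageInputs_three_of_mem_inertSet`, p563651), so the re-keyed END serves the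
corner; at `p ∈ {5, 7}` they hold on the non-surjective corners given `−1 ∈ ρ̄(Γ_ℚ)` (shim3b
`McCallum1991_cor_3_2_pow_of_irr_of_neg`). No new mathematics is claimed in the re-keyed files.

## THIS FILE = shim-p1's `…InertShiftEnd` (p482014) §2–§3, re-keyed (the `M₀ = 0` END of the inert ORDER chain)

* `sha_primary_eq_zero_of_ringClassRationalPointsM_shift_ofImage` — `Ш(E/K)[p^∞] = 0` on the inert locus (`hin` ∕
  `hsp` VERBATIM) from `P ∉ pE(K)`, Kolyvagin reciprocity (R)_M and the depth-`k` ring-class-rational carrier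
  `hpointsRk`, the Selmer clause at every `v ∤ m` being shim3a's `p`-generic level-shift lemma
  (`ShimuraKolyvaginLocalShift.kolyvaginClass_mem_selmerLocalKer_of_ringClassRational_shift`) at the depth
  `k₀ = 1 + Σ_{ℓ ∣ N} v_p(ord_ℓ Δ_min(E/ℚ))` (`padicValNat_ordMinimalDiscriminant_le_of_split`, used from the tree).
* `natCard_primaryComponent_sha_le_of_ringClassRationalPointsM_shift_of_poitouTate_ofImage` — the `Nat.card` shape
  for `ord_p[E(K):ℤP] = 0` from `hpointsRk` and the Poitou–Tate named fact `hPT` (CONDITIONAL on it).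
Besides `hρ` ↦ `(hIz) (hIs) (hIc) (hIt)`, the binder `5 ≤ p` of the originals (used there only for `p ≠ 2`; the
Tamagawa clause is gone since the level shift) is replaced by `p ≠ 2`: ANY odd `p`, in particular `p = 3`.
[cite: McCallumLMS1991, §1 Theorem (Kolyvagin), §4 Lemma 4.3, Lemma 4.6, §5 Lemma 5.1] [cite: GrossLMS1991, Prop. 2.1 (2), Prop. 6.2 (1), §10]
[cite: Howard2004Duke, Thm. 3.2.2 (proof), Lemma 3.3.5] [cite: SilvermanAEC2009, Thm. VII.6.1, Prop. VII.5.4 (a)]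
[cite: MilneADT2006, Ch. I Prop. 3.8, Thm. 4.10(b)]
presearch: as I2 (cell D8 audit; shim3b g5 §1).
-/

noncomputable section

open scoped Classical Pointwise AddSubgroup

set_option linter.dupNamespace false

universe u

namespace Summit.BirchSwinnertonDyer.BirchSwinnertonDyer.Theorems.ShimuraKolyvaginOfImage

open Summit.BirchSwinnertonDyer.BirchSwinnertonDyer.Theorems.ShimuraKolyvaginLocalShift

open WeierstrassCurve NumberField IsDedekindDomain Field Function
  Literature.NumberTheory.EllipticCurves Literature.NumberTheory.EllipticCurves.KolyvaginCocycle
  Literature.NumberTheory.EllipticCurves.RingClassField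
  Literature.NumberTheory.GaloisRepresentations Literature.NumberTheory.NumberFields
  Literature.NumberTheory.GaloisCohomology
  Summit.BirchSwinnertonDyer.Rank1Residual.X11b
  Summit.BirchSwinnertonDyer.BirchSwinnertonDyer.Theorems.ShimuraKolyvaginLocalShift

variable {K : Type} [Field K] [NumberField K]

/-! ### §1 The ℚ-side bound for the `p`-part of the Kodaira–Néron exponents on the crux's locus -/

/-! ### §2 `Ш(E/K)[p^∞] = 0` on the locus of item 19718 from the depth-`k` ring-class-rational carrier — NO `hTam` -/

/-- **`Ш(E/K)[p^∞] = 0` on the locus of item 19718 from `P ∉ pE(K)`, the RING-CLASS-RATIONAL Euler-system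
carrier read at depth `k`, and Kolyvagin reciprocity — with NO Tamagawa clause.** Binders: the crux's `W`
(globally minimal, conductor `N`), `p` odd with the four image inputs (hIz) (hIs) (hIc) (hIt) (in place of `p ≥ 5`, `ρ̄_{E,p}` onto), `K` imaginary quadratic with `ι : K → ℂ`,
the inert set `S` with the crux's clauses `hin` ∕ `hsp` VERBATIM; a non-torsion `P ∈ E(K)` with `p ∤ P` in
`E(K)`; `hpointsRk` — for EVERY depth `k` and every `M ≥ 1`: a sign `ε`, a lift `τ` of `c`, modules
`A_m ≤ E(K̄)` admissible for `p^M` AND for `p^{M+k}` (printed: `A_m = E(K[m])`, no `p`-torsion at all,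
Gross Lemma 4.3), `K`-embeddings `emb m : K[m] → K̄` with every point of `A_m` rational over `emb m (K[m])`
(Gross (4.1), BD96 §2.3–2.5), points `P_m ∈ A_m` invariant modulo `p^M` with `P_1 = P`, and, for the
square-free products `m` of Kolyvagin primes with `Frob = Frob(∞)` on `E[p^{M+k}]`: `P_m` invariant modulo
`p^{M+k}` (McCallum (4) at depth `M + k`: `a_ℓ ≡ ℓ + 1 ≡ 0 mod p^{M+k}`), Gross 5.4 (1) (eigen relation
modulo `p^M A_m`) and McCallum 4.4 at `λ ∣ m` for the LEVEL-`p^M` classes; plus (R)_M `hR` at the level-`M`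
Kolyvagin primes. Conclusion: every element of `Ш(E/K)` killed by a power of `p` is `0`. Proof: file III's
`sha_primary_eq_zero_at_of_pointsM_shift_of_reciprocityM_of_not_dvd_of_conductorNorm_ofImage` at the depth
`k₀ = 1 + Σ_{ℓ ∣ N} v_p(ord_ℓ Δ_min(E/ℚ))`, the Selmer clause (d) at EVERY `v ∤ m` being shim3a's LEVEL-SHIFT
lemma `ShimuraKolyvaginLocalShift.kolyvaginClass_mem_selmerLocalKer_of_ringClassRational_shift` with §1.
Compared with `…InertMachineEntry` §4 (`sha_primary_eq_zero_of_ringClassRationalPointsM`, g7): the clause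
`hTam` is DELETED, the carrier is read one notch deeper. HONEST: this is S1 of the skeleton MODULO (a) the
Shimura Euler-system carrier in this currency (BD96 §2, Nekovář 2007 (4.8)–(4.13) — printed, not in the
tree), (b) (R)_M (from Poitou–Tate, `…InertReciprocity` §1), (c) the index guard of the `Nat.card` form
below; item 19718 and S1 ∕ S2 stay OPEN. [cite: GrossLMS1991, §1 Thm. 1.3 (2), Prop. 2.1 (2), §§3–8, §10]
[cite: McCallumLMS1991, §1, §§4–5, Lemma 4.6] [cite: BertoliniDarmon1996, §2.3–2.6, Prop. 2.6]
[cite: Howard2004Duke, Thm. 3.2.2 (proof)] [cite: Kim2022HigherGZ, §2.1 and Thm. 4.3] -/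
theorem sha_primary_eq_zero_of_ringClassRationalPointsM_shift_ofImage
    (W : WeierstrassCurve ℚ) [W.IsElliptic] [W.IsGloballyMinimal] {N : ℕ} [NeZero N]
    (hN : W.conductorNorm ℤ = N) {p : ℕ} (hp : p.Prime) (hp2 : p ≠ 2)
    (hIz : ∃ z : absoluteGaloisGroup K, ∀ t : geomTorsion (W.baseChange K) p, z • t = -t)
    (hIs : (W.baseChange K).HasIrreducibleModPGaloisRep p)
    (hIc : ∀ f : geomTorsion (W.baseChange K) p →+ geomTorsion (W.baseChange K) p,
      (∀ (g : absoluteGaloisGroup K) (t : geomTorsion (W.baseChange K) p), f (g • t) = g • f t) →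
        ∃ k : ℤ, ∀ t, f t = k • t)
    (hIt : AddSubgroup.torsionBy (W.baseChange K).toAffine.Point (p : ℤ) = ⊥) (hK : IsImaginaryQuadratic K) (ι : K →+* ℂ)
    {S : Finset ℕ}
    (hin : ∀ ℓ ∈ S, ℓ.Prime ∧ ℓ ∣ N ∧ ¬ ℓ ^ 2 ∣ N ∧
      ((Ideal.span {(ℓ : ℤ)}).primesOver (𝓞 K)).ncard = 1 ∧ ¬ (ℓ : ℤ) ∣ NumberField.discr K)
    (hsp : ∀ ℓ : ℕ, ℓ.Prime → ℓ ∣ N → ℓ ∉ S → ((Ideal.span {(ℓ : ℤ)}).primesOver (𝓞 K)).ncard = 2)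
    {P : (W.baseChange K).toAffine.Point} (hnt : ¬ IsOfFinAddOrder P)
    (hndvd : ∀ Q : (W.baseChange K).toAffine.Point, p • Q ≠ P)
    (hpointsRk : ∀ (k : ℕ) {M : ℕ} (_hM : 1 ≤ M)
      (hdiv : ∀ Q : geomPoints (W.baseChange K), ∃ R, ((p ^ M : ℕ) : ℤ) • R = Q)
      (c : K ≃ₐ[ℚ] K) (_hc : c ≠ 1),
      ∃ (ε : ℤ) (τ : AlgebraicClosure K ≃+* AlgebraicClosure K) (hτ : IsLiftOfAut c τ)
        (A : ℕ → AddSubgroup (geomPoints (W.baseChange K)))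
        (hA : ∀ m, KolyvaginCocycle.IsAdmissible (Field.absoluteGaloisGroup K) (A m)
          ((p ^ M : ℕ) : ℤ))
        (emb : ∀ m : ℕ, ringClassField K ι m →ₐ[K] AlgebraicClosure K)
        (Pt : ℕ → geomPoints (W.baseChange K))
        (hPt : ∀ m, Pt m ∈
          KolyvaginCocycle.invPoints (Field.absoluteGaloisGroup K) (A m) ((p ^ M : ℕ) : ℤ)),
        (ε = 1 ∨ ε = -1) ∧
        IsOfFinAddOrder (Affine.Point.map (W' := W) (c : K →ₐ[ℚ] K) P - ε • P) ∧
        (∀ m, ∀ a ∈ A m, hτ.pointsMap W a ∈ A m) ∧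
        Pt 1 = toGeomPoints (W.baseChange K) P ∧
        (∀ m, m ≠ 0 → ∀ a ∈ A m, ∀ Φ : Field.absoluteGaloisGroup K,
          (∀ x : ringClassField K ι m, Φ • emb m x = emb m x) → Φ • a = a) ∧
        (∀ m, KolyvaginCocycle.IsAdmissible (Field.absoluteGaloisGroup K) (A m)
          ((p ^ (M + k) : ℕ) : ℤ)) ∧
        (∀ m : ℕ, Squarefree m →
          (∀ q ∈ m.primeFactors, IsKolyvaginPrime N W K p q ∧ FrobEqFrobInfty W K (p ^ (M + k)) q) →
          Pt m ∈ KolyvaginCocycle.invPoints (Field.absoluteGaloisGroup K) (A m)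
            ((p ^ (M + k) : ℕ) : ℤ) ∧
          (∃ B ∈ A m, hτ.pointsMap W (Pt m) =
            (ε * (-1) ^ m.primeFactors.card) • Pt m + ((p ^ M : ℕ) : ℤ) • B) ∧
          (∀ ℓ : ℕ, ℓ.Prime → ℓ ∣ m → ∀ v : HeightOneSpectrum (𝓞 K), (ℓ : 𝓞 K) ∈ v.asIdeal →
            ∀ a : ℕ, (((p : ℤ) ^ a) •
                kolyvaginClass (W.baseChange K) _ hdiv (hA m) (Pt m) (hPt m) ∈
                selmerLocalKer (W.baseChange K) (v.adicCompletion K) ((p ^ M : ℕ) : ℤ) ↔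
              ((p : ℤ) ^ a) • kolyvaginClass (W.baseChange K) _ hdiv (hA (m / ℓ)) (Pt (m / ℓ))
                  (hPt (m / ℓ)) ∈
                (W.baseChange K).torsionLocalKer (v.adicCompletion K) ((p ^ M : ℕ) : ℤ)))))
    (hR : ∀ {M : ℕ} (_hM : 1 ≤ M) {ℓ : ℕ} (hℓ : IsKolyvaginPrime N W K p ℓ),
      FrobEqFrobInfty W K (p ^ M) ℓ →
      ∃ (A : Type) (_ : AddCommGroup A)
        (e : geomTorsion (W.baseChange K) ((p ^ M : ℕ) : ℤ) →+
          geomTorsion (W.baseChange K) ((p ^ M : ℕ) : ℤ) →+ A),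
        (∀ x, e x x = 0) ∧ (∀ x, (∀ y, e x y = 0) → x = 0) ∧
        ∀ s ∈ selmerGroup (W.baseChange K) ((p ^ M : ℕ) : ℤ),
          ∀ c' : galH1Torsion (W.baseChange K) ((p ^ M : ℕ) : ℤ),
          (∀ v : HeightOneSpectrum (𝓞 K), (ℓ : 𝓞 K) ∉ v.asIdeal →
            c' ∈ selmerLocalKer (W.baseChange K) (v.adicCompletion K) ((p ^ M : ℕ) : ℤ)) →
          (∀ w : InfinitePlace K,
            c' ∈ selmerLocalKer (W.baseChange K) w.Completion ((p ^ M : ℕ) : ℤ)) →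
          ∀ 𝔔 ∈ hℓ.place.primesAbove, ∀ F : Field.absoluteGaloisGroup K,
            IsArithFrobAt (𝓞 K) F 𝔔 →
            F ∈ torsionFixing (W.baseChange K) ((p ^ M : ℕ) : ℤ) →
            ∀ σ ∈ 𝔔.inertia (Field.absoluteGaloisGroup K),
            e (h1Eval (W.baseChange K) ((p ^ M : ℕ) : ℤ) s F)
              (h1Eval (W.baseChange K) ((p ^ M : ℕ) : ℤ) c' σ) = 0) :
    ∀ d : (W.baseChange K).sha, (∃ j : ℕ, p ^ j • d = 0) → d = 0 := by
  haveI : (W.baseChange K).IsElliptic := inferInstanceAs (W.map (algebraMap ℚ K)).IsElliptic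
  -- the depth `k₀` absorbing the `p`-parts of all Kodaira–Néron exponents on the locus
  set k₀ : ℕ := 1 + ∑ q ∈ N.primeFactors, padicValNat p (padicValInt q W.minimalDiscriminantInt) with hk₀
  have hk1 : 1 ≤ k₀ := Nat.le_add_right 1 _
  have hkm : ∀ w : HeightOneSpectrum (𝓞 K), (W.baseChange K).HasMultiplicativeReductionAt w →
      ((Rat.HeightOneSpectrum.primesEquiv (w.under (𝓞 ℚ)) : ℕ)) ∉ S →
      padicValNat p ((W.baseChange K).ordMinimalDiscriminant w) ≤ k₀ := fun w hmw hℓS ↦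
    padicValNat_ordMinimalDiscriminant_le_of_split hK W hN p hsp w hmw hℓS
  refine sha_primary_eq_zero_at_of_pointsM_shift_of_reciprocityM_of_not_dvd_of_conductorNorm_ofImage W hN hK hnt
    hp hp2 hIz hIs hIc hIt k₀ hndvd ?_ hR
  intro M hM hdiv c hc
  obtain ⟨ε, τ, hτ, A, hA, emb, Pt, hPt, hε, h53, hAτ, hPt1, hrat, hAk, hm'⟩ := hpointsRk k₀ hM hdiv c hc
  refine ⟨ε, τ, hτ, A, hA, Pt, hPt, hε, h53, hAτ, hPt1, fun m hm hk ↦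
    ⟨(hm' m hm hk).2.1, ?_, (hm' m hm hk).2.2⟩⟩
  intro v hv
  have hm0 : m ≠ 0 := Squarefree.ne_zero hm
  exact kolyvaginClass_mem_selmerLocalKer_of_ringClassRational_shift hK ι hm0 (emb m) W hp hp2 hin hk1
    hkm (fun q hq ↦ (hk q hq).1.2.1) (hA m) (hAk m) (hrat m hm0) (hPt m) ((hm' m hm hk).1) v hv

/-! ### §3 S1's `Nat.card` shape on the locus of item 19718, modulo the depth-`k` carrier and Poitou–Tate — NO `hTam` -/

/-- **S1's conclusion `#Ш(E/K)[p^∞] ≤ p^{2·ord_p[E(K):ℤP]}` (here `= 1`) on the locus of item 19718, from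
the depth-`k` ring-class-rational Euler-system data and the Poitou–Tate named fact — WITHOUT the Tamagawa
clause.** Binders: the crux's (`W` globally minimal of conductor `N`, `[Fact p.Prime]`, `p ≠ 2`, the four image inputs
(hIz) (hIs) (hIc) (hIt), `K` imaginary quadratic, `hin`, `hsp`) + `ι : K → ℂ` + `P ∈ E(K)` non-torsion with
`padicValNat p [E(K):ℤP] = 0` AND the guard `0 < [E(K):ℤP]` + `hpointsRk` (§2) + `hPT` (Poitou–Tate,
cite-only named fact, conjunct 14 of `PublishedInputsFive` ⇒ this theorem is CONDITIONAL on it). Proof: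
(R)_M from `kolyvaginReciprocityM_of_poitouTate_of_conductorNorm` (p471634 §1), `P ∉ pE(K)` from
`nsmul_ne_of_padicValNat_index_eq_zero` (p471634 §2), `Ш(E/K)[p^∞] = 0` from §2; the `p`-primary component
is `⊥`. This is g7's `natCard_primaryComponent_sha_le_of_ringClassRationalPointsM_of_poitouTate` with the
hypothesis `hTam` DELETED (planner g28: the level shift makes the Tamagawa clause dead weight). HONEST: S1
stays OPEN — the gap to its registered signature is now exactly {`hpointsRk` (printed carrier, read one
notch deeper), `hPT`, `0 < index`}; S1's data `Dt X W' P₀ degS` + GZ display are not used.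
[cite: GrossLMS1991, Prop. 2.1 (2)] [cite: McCallumLMS1991, §1 Theorem (Kolyvagin), Lemma 4.6, Lemma 5.1]
[cite: MilneADT2006, Ch. I Thm. 4.10(b)] [cite: Howard2004Duke, Thm. 3.2.2 (proof)] -/
theorem natCard_primaryComponent_sha_le_of_ringClassRationalPointsM_shift_of_poitouTate_ofImage
    (hPT : poitouTate_sum_localTatePairing_eq_zero K)
    (W : WeierstrassCurve ℚ) [W.IsElliptic] [W.IsGloballyMinimal] {N : ℕ} [NeZero N]
    (hN : W.conductorNorm ℤ = N) {p : ℕ} [Fact p.Prime] (hp2 : p ≠ 2)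
    (hIz : ∃ z : absoluteGaloisGroup K, ∀ t : geomTorsion (W.baseChange K) p, z • t = -t)
    (hIs : (W.baseChange K).HasIrreducibleModPGaloisRep p)
    (hIc : ∀ f : geomTorsion (W.baseChange K) p →+ geomTorsion (W.baseChange K) p,
      (∀ (g : absoluteGaloisGroup K) (t : geomTorsion (W.baseChange K) p), f (g • t) = g • f t) →
        ∃ k : ℤ, ∀ t, f t = k • t)
    (hIt : AddSubgroup.torsionBy (W.baseChange K).toAffine.Point (p : ℤ) = ⊥) (hK : IsImaginaryQuadratic K) (ι : K →+* ℂ)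
    {S : Finset ℕ}
    (hin : ∀ ℓ ∈ S, ℓ.Prime ∧ ℓ ∣ N ∧ ¬ ℓ ^ 2 ∣ N ∧
      ((Ideal.span {(ℓ : ℤ)}).primesOver (𝓞 K)).ncard = 1 ∧ ¬ (ℓ : ℤ) ∣ NumberField.discr K)
    (hsp : ∀ ℓ : ℕ, ℓ.Prime → ℓ ∣ N → ℓ ∉ S → ((Ideal.span {(ℓ : ℤ)}).primesOver (𝓞 K)).ncard = 2)
    {P : (W.baseChange K).toAffine.Point} (hnt : ¬ IsOfFinAddOrder P)
    (hidx0 : 0 < (AddSubgroup.zmultiples P).index)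
    (hidx : padicValNat p (AddSubgroup.zmultiples P).index = 0)
    (hpointsRk : ∀ (k : ℕ) {M : ℕ} (_hM : 1 ≤ M)
      (hdiv : ∀ Q : geomPoints (W.baseChange K), ∃ R, ((p ^ M : ℕ) : ℤ) • R = Q)
      (c : K ≃ₐ[ℚ] K) (_hc : c ≠ 1),
      ∃ (ε : ℤ) (τ : AlgebraicClosure K ≃+* AlgebraicClosure K) (hτ : IsLiftOfAut c τ)
        (A : ℕ → AddSubgroup (geomPoints (W.baseChange K)))
        (hA : ∀ m, KolyvaginCocycle.IsAdmissible (Field.absoluteGaloisGroup K) (A m)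
          ((p ^ M : ℕ) : ℤ))
        (emb : ∀ m : ℕ, ringClassField K ι m →ₐ[K] AlgebraicClosure K)
        (Pt : ℕ → geomPoints (W.baseChange K))
        (hPt : ∀ m, Pt m ∈
          KolyvaginCocycle.invPoints (Field.absoluteGaloisGroup K) (A m) ((p ^ M : ℕ) : ℤ)),
        (ε = 1 ∨ ε = -1) ∧
        IsOfFinAddOrder (Affine.Point.map (W' := W) (c : K →ₐ[ℚ] K) P - ε • P) ∧
        (∀ m, ∀ a ∈ A m, hτ.pointsMap W a ∈ A m) ∧
        Pt 1 = toGeomPoints (W.baseChange K) P ∧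
        (∀ m, m ≠ 0 → ∀ a ∈ A m, ∀ Φ : Field.absoluteGaloisGroup K,
          (∀ x : ringClassField K ι m, Φ • emb m x = emb m x) → Φ • a = a) ∧
        (∀ m, KolyvaginCocycle.IsAdmissible (Field.absoluteGaloisGroup K) (A m)
          ((p ^ (M + k) : ℕ) : ℤ)) ∧
        (∀ m : ℕ, Squarefree m →
          (∀ q ∈ m.primeFactors, IsKolyvaginPrime N W K p q ∧ FrobEqFrobInfty W K (p ^ (M + k)) q) →
          Pt m ∈ KolyvaginCocycle.invPoints (Field.absoluteGaloisGroup K) (A m)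
            ((p ^ (M + k) : ℕ) : ℤ) ∧
          (∃ B ∈ A m, hτ.pointsMap W (Pt m) =
            (ε * (-1) ^ m.primeFactors.card) • Pt m + ((p ^ M : ℕ) : ℤ) • B) ∧
          (∀ ℓ : ℕ, ℓ.Prime → ℓ ∣ m → ∀ v : HeightOneSpectrum (𝓞 K), (ℓ : 𝓞 K) ∈ v.asIdeal →
            ∀ a : ℕ, (((p : ℤ) ^ a) •
                kolyvaginClass (W.baseChange K) _ hdiv (hA m) (Pt m) (hPt m) ∈
                selmerLocalKer (W.baseChange K) (v.adicCompletion K) ((p ^ M : ℕ) : ℤ) ↔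
              ((p : ℤ) ^ a) • kolyvaginClass (W.baseChange K) _ hdiv (hA (m / ℓ)) (Pt (m / ℓ))
                  (hPt (m / ℓ)) ∈
                (W.baseChange K).torsionLocalKer (v.adicCompletion K) ((p ^ M : ℕ) : ℤ))))) :
    Nat.card (AddCommGroup.primaryComponent (W.baseChange K).sha p) ≤
      p ^ (2 * padicValNat p (AddSubgroup.zmultiples P).index) := by
  have hp : p.Prime := Fact.out
  have hndvd : ∀ Q : (W.baseChange K).toAffine.Point, p • Q ≠ P :=
    nsmul_ne_of_padicValNat_index_eq_zero hnt hp hidx0 hidx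
  have h0 := sha_primary_eq_zero_of_ringClassRationalPointsM_shift_ofImage W hN hp hp2 hIz hIs hIc hIt hK ι hin hsp hnt hndvd
    hpointsRk (@fun _ hM _ hℓ _ ↦ kolyvaginReciprocityM_of_poitouTate_of_conductorNorm W hN hPT hp hM hℓ)
  have hbot : AddCommGroup.primaryComponent (W.baseChange K).sha p = ⊥ := by
    refine (AddSubgroup.eq_bot_iff_forall _).mpr fun x hx ↦ ?_
    obtain ⟨n, hn⟩ := (AddCommGroup.mem_primaryComponent).1 hx
    exact h0 x ⟨n, hn⟩
  rw [hbot, AddSubgroup.card_bot, hidx, mul_zero, pow_zero]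

end Summit.BirchSwinnertonDyer.BirchSwinnertonDyer.Theorems.ShimuraKolyvaginOfImage

end
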